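/-
Copyright (c) 2026 the pub-hodgecm-mathlib formalisation cell (harness21).  Prover seat hodgecm-mathlib-K2E2-p12 (g6): Track B «K2-LIT», ENGINE E1,
h413 = stmt-HodgeConjecture-24833; R8₂-sph ROAD T′, road (A) GELFAND, deal (179) of K2E1-plan (g7), FILE A of the `hcommHecke` ASSEMBLY: the Hilbert-space bookkeeping of
fixed-vector projections of COMMUTING families (inputs (L1)(F1)(F2)(F3) of ★ `K2E1HeckeCommuteGluingU`).
-/
import Summits.HodgeConjecture.HodgeConjecture.Theorems.K2E1HeckeCommuteOfOrbitalU     -- ★ (this seat, p859855): `commute_starProjection_of_mem`, `rep_apply_starProjection_eq`, `starProjection_rep_apply_eq`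
import HarnessLib

/-!
# K2·E1 — `K2E1FixedProjectionsCommuteU` (deal (179), FILE A): ORTHOGONAL PROJECTIONS ONTO THE FIXED VECTORS OF COMMUTING FAMILIES — they commute with the centralising operators,
# with each other, and multiply to the projection onto the joint fixed vectors [Deitmar–Echterhoff Lemma 7.3.1; Bump §3.4; Flath §2]

Track B ∕ K2-LIT, crux h413 = `stmt-HodgeConjecture-24833`, route of record `HCCMUnconditional`; cell `hodgecm-mathlib`, squad K2, ENGINE E1 (R8₂-sph ROAD T′, road (A) GELFAND;
the `hcommHecke` ASSEMBLY (179): FILE A generic Hilbert lemmas → FILE B adelic peeling → FILE C assembly through ★ GLUING p859808).  THEOREMS ONLY (no `def`, no `instance`, no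
notation, no `sorry`; default heartbeats); lane `--supports stmt-HodgeConjecture-24833 --as helper` (count-neutral).  GENERIC: `π` a UNITARY representation of a group `G` on a
Hilbert space `H`; a family `S ⊆ G` and «its» fixed-vector submodule `U` are tied by the hypothesis `hU : ∀ v, v ∈ U ↔ ∀ s ∈ S, π s v = v` (no definition is introduced).
* §1 `mem_fixed_of_mem_closure` — a vector fixed by `S` is fixed by the subgroup `S` generates; `isClosed_of_fixed'`∕`hasOrthogonalProjection_of_fixed'` (closed, has a projection);
  `fixed_union_eq_inf` — the fixed vectors of `S₁ ∪ S₂` (or of the subgroup generated) are `U₁ ⊓ U₂`.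
* §2 **`commute_starProjection_rep_of_centralizer`** — if `x` commutes with every `s ∈ S` then `P_U` commutes with `π x` ((L1)∕(F2) of ★ GLUING);
  **`commute_starProjection_of_commuting_families`** — for elementwise-commuting `S₁`, `S₂` the projections `P_{U₁}`, `P_{U₂}` commute ((F3));
  **`starProjection_inf_eq_mul_of_commute`** — commuting orthogonal projections multiply to the projection onto the intersection, whence
  **`starProjection_fixed_union_eq_mul`** — `P_{Fix(S₁ ∪ S₂)} = P_{U₁} * P_{U₂}` for commuting families (the PEELING identity (F1)).
HONEST LABEL: HC_CM is proved only modulo the 7 printed citations (2 remaining named inputs: hLiu418 = `stmt-HodgeConjecture-24832`, h413 = `stmt-HodgeConjecture-24833`) until rung 0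
closes; this file asserts no named fact and closes no socket; count-neutral; unconditional Hilbert-space representation theory.

## References
* [DeitmarEchterhoff2014] A. Deitmar, S. Echterhoff, *Principles of Harmonic Analysis*, 2nd ed. (2014): Lemma 7.3.1 (fixed vectors and their projection).
* [Bump1997] D. Bump, *Automorphic Forms and Representations* (1997): §3.4 (pp. 314–315), Thm. 2.4.2.
* [Flath1979] D. Flath, *Decomposition of representations into tensor products*, PSPM 33.1 (1979): §2.
-/

set_option autoImplicit false
set_option linter.dupNamespace false -- the mandated namespace repeats `HodgeConjecture.HodgeConjecture`

noncomputable section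

open scoped InnerProductSpace
open ContRepresentation
open Summit.HodgeConjecture.HodgeConjecture.Cruxes.H413.K2E1HeckeCommuteOfOrbitalU (commute_starProjection_of_mem rep_apply_starProjection_eq starProjection_rep_apply_eq)

namespace Summit.HodgeConjecture.HodgeConjecture.Cruxes.H413.K2E1FixedProjectionsCommuteU

variable {G H : Type*} [Group G] [NormedAddCommGroup H] [InnerProductSpace ℂ H] {π : ContRepresentation ℂ G H}

/-! ## §1 Fixed vectors of a family, of the subgroup it generates, of a union -/

omit [InnerProductSpace ℂ H] in
/-- A vector fixed by every `s ∈ S` is fixed by the subgroup generated by `S` (the fixer of a vector is a subgroup). [cite: DeitmarEchterhoff2014, Lemma 7.3.1] -/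
theorem mem_fixed_of_mem_closure [Module ℂ H] {π : ContRepresentation ℂ G H} (S : Set G) {v : H} (hv : ∀ s ∈ S, π s v = v) :
    ∀ g ∈ Subgroup.closure S, π g v = v := by
  intro g hg
  refine Subgroup.closure_induction (p := fun g _ => π g v = v) (fun s hs => hv s hs) (by rw [map_one]; rfl)
    (fun a b _ _ ha hb => by rw [map_mul]; exact (show π a (π b v) = v by rw [hb, ha])) (fun a _ ha => ?_) hg
  calc π a⁻¹ v = π a⁻¹ (π a v) := by rw [ha]
    _ = (π a⁻¹ * π a) v := rfl
    _ = v := by rw [← map_mul, inv_mul_cancel, map_one]; rfl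

omit [InnerProductSpace ℂ H] in
/-- The fixed vectors of a family form a CLOSED subspace. [cite: DeitmarEchterhoff2014, Lemma 7.3.1] -/
theorem isClosed_of_fixed' [Module ℂ H] {π : ContRepresentation ℂ G H} (S : Set G) (U : Submodule ℂ H) (hU : ∀ v : H, v ∈ U ↔ ∀ s ∈ S, π s v = v) :
    IsClosed (U : Set H) := by
  have hset : (U : Set H) = ⋂ s ∈ S, {v : H | π s v = v} := by
    ext v
    simp only [SetLike.mem_coe, Set.mem_iInter, Set.mem_setOf_eq]
    exact hU v
  rw [hset]
  exact isClosed_biInter fun s _ => isClosed_eq (π s).continuous continuous_id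

/-- In a Hilbert space the fixed vectors of a family HAVE an orthogonal projection. [cite: DeitmarEchterhoff2014, Lemma 7.3.1] -/
theorem hasOrthogonalProjection_of_fixed' [CompleteSpace H] (S : Set G) (U : Submodule ℂ H) (hU : ∀ v : H, v ∈ U ↔ ∀ s ∈ S, π s v = v) :
    U.HasOrthogonalProjection := by
  haveI : CompleteSpace U := (isClosed_of_fixed' S U hU).completeSpace_coe
  exact Submodule.HasOrthogonalProjection.ofCompleteSpace U

omit [InnerProductSpace ℂ H] in
/-- **The fixed vectors of `S₁ ∪ S₂` are `U₁ ⊓ U₂`**; more generally any family `S` with `S₁ ∪ S₂ ⊆ S ⊆ ⟨S₁ ∪ S₂⟩` has fixed vectors `U₁ ⊓ U₂`. [cite: Flath1979, §2] -/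
theorem fixed_eq_inf_of_subset_closure [Module ℂ H] {π : ContRepresentation ℂ G H} (S₁ S₂ S : Set G) (U₁ U₂ U : Submodule ℂ H)
    (hU₁ : ∀ v : H, v ∈ U₁ ↔ ∀ s ∈ S₁, π s v = v) (hU₂ : ∀ v : H, v ∈ U₂ ↔ ∀ s ∈ S₂, π s v = v) (hU : ∀ v : H, v ∈ U ↔ ∀ s ∈ S, π s v = v)
    (h₁ : S₁ ⊆ S) (h₂ : S₂ ⊆ S) (hS : S ⊆ Subgroup.closure (S₁ ∪ S₂)) : U = U₁ ⊓ U₂ := by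
  ext v
  rw [Submodule.mem_inf, hU, hU₁, hU₂]
  refine ⟨fun h => ⟨fun s hs => h s (h₁ hs), fun s hs => h s (h₂ hs)⟩, fun h s hs => ?_⟩
  refine mem_fixed_of_mem_closure (S₁ ∪ S₂) (fun t ht => ?_) s (hS hs)
  rcases ht with ht | ht
  · exact h.1 t ht
  · exact h.2 t ht

/-! ## §2 Projections onto fixed vectors: commuting with the centraliser, with each other, and the product formula -/

section Hilbert

variable [CompleteSpace H]

/-- **`P_U` COMMUTES WITH `π(x)` WHEN `x` CENTRALISES `S`** (`π` unitary): `π(x)` and `π(x)† = π(x⁻¹)` both preserve `U`. — inputs (L1)∕(F2) of ★ `K2E1HeckeCommuteGluingU`.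
[cite: DeitmarEchterhoff2014, Lemma 7.3.1] [cite: Flath1979, §2] -/
theorem commute_starProjection_rep_of_centralizer (hu : π.IsUnitary) (S : Set G) (U : Submodule ℂ H) (hU : ∀ v : H, v ∈ U ↔ ∀ s ∈ S, π s v = v)
    [U.HasOrthogonalProjection] {x : G} (hx : ∀ s ∈ S, x * s = s * x) : Commute U.starProjection (π x) := by
  have hpres : ∀ (y : G), (∀ s ∈ S, y * s = s * y) → ∀ u ∈ U, π y u ∈ U := by
    intro y hy u hu'
    rw [hU]
    intro s hs
    calc π s (π y u) = (π s * π y) u := rfl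
      _ = (π y * π s) u := by rw [← map_mul, ← hy s hs, map_mul]
      _ = π y (π s u) := rfl
      _ = π y u := by rw [(hU u).1 hu' s hs]
  refine commute_starProjection_of_mem U (π x) (hpres x hx) fun u hu' => ?_
  rw [hu.adjoint_apply]
  refine hpres x⁻¹ (fun s hs => ?_) u hu'
  calc x⁻¹ * s = x⁻¹ * (s * x) * x⁻¹ := by group
    _ = x⁻¹ * (x * s) * x⁻¹ := by rw [hx s hs]
    _ = s * x⁻¹ := by group

/-- **PROJECTIONS ONTO THE FIXED VECTORS OF ELEMENTWISE-COMMUTING FAMILIES COMMUTE** (`π` unitary): `P_{U₁}` commutes with every `π(t)`, `t ∈ S₂`, hence preserves `U₂`, and is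
self-adjoint. — input (F3) of ★ `K2E1HeckeCommuteGluingU`. [cite: Flath1979, §2] [cite: DeitmarEchterhoff2014, Lemma 7.3.1] -/
theorem commute_starProjection_of_commuting_families (hu : π.IsUnitary) (S₁ S₂ : Set G) (U₁ U₂ : Submodule ℂ H)
    (hU₁ : ∀ v : H, v ∈ U₁ ↔ ∀ s ∈ S₁, π s v = v) (hU₂ : ∀ v : H, v ∈ U₂ ↔ ∀ s ∈ S₂, π s v = v)
    [U₁.HasOrthogonalProjection] [U₂.HasOrthogonalProjection] (h : ∀ s ∈ S₁, ∀ t ∈ S₂, s * t = t * s) :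
    Commute U₁.starProjection U₂.starProjection := by
  have hpres : ∀ u ∈ U₂, U₁.starProjection u ∈ U₂ := by
    intro u hu'
    rw [hU₂]
    intro t ht
    have hc : Commute U₁.starProjection (π t) := commute_starProjection_rep_of_centralizer hu S₁ U₁ hU₁ fun s hs => (h s hs t ht).symm
    calc π t (U₁.starProjection u) = (π t * U₁.starProjection) u := rfl
      _ = (U₁.starProjection * π t) u := by rw [hc.eq]
      _ = U₁.starProjection (π t u) := rfl
      _ = U₁.starProjection u := by rw [(hU₂ u).1 hu' t ht]
  refine (commute_starProjection_of_mem U₂ U₁.starProjection hpres fun u hu' => ?_).symm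
  rw [(isSelfAdjoint_starProjection U₁).adjoint_eq]
  exact hpres u hu'

omit [CompleteSpace H] in
/-- **COMMUTING ORTHOGONAL PROJECTIONS MULTIPLY TO THE PROJECTION ONTO THE INTERSECTION**: `P_{U ⊓ W} = P_U P_W` (`P_U P_W u ∈ U ⊓ W`, and `u − P_U P_W u ⟂ U ⊓ W` by self-adjointness).
[cite: DeitmarEchterhoff2014, Lemma 7.3.1] -/
theorem starProjection_inf_eq_mul_of_commute (U W : Submodule ℂ H) [U.HasOrthogonalProjection] [W.HasOrthogonalProjection] [(U ⊓ W).HasOrthogonalProjection]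
    (h : Commute U.starProjection W.starProjection) : (U ⊓ W).starProjection = U.starProjection * W.starProjection := by
  refine ContinuousLinearMap.ext fun u => ?_
  change (U ⊓ W).starProjection u = U.starProjection (W.starProjection u)
  have hmemU : U.starProjection (W.starProjection u) ∈ U := U.starProjection_apply_mem _
  have hmemW : U.starProjection (W.starProjection u) ∈ W := by
    have : U.starProjection (W.starProjection u) = W.starProjection (U.starProjection u) := by
      change (U.starProjection * W.starProjection) u = (W.starProjection * U.starProjection) u
      rw [h.eq]
    rw [this]
    exact W.starProjection_apply_mem _
  refine Submodule.eq_starProjection_of_mem_of_inner_eq_zero ⟨hmemU, hmemW⟩ fun z hz => ?_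
  rw [inner_sub_left, Submodule.inner_starProjection_left_eq_right, Submodule.inner_starProjection_left_eq_right,
    Submodule.starProjection_eq_self_iff.2 hz.1, Submodule.starProjection_eq_self_iff.2 hz.2, sub_self]

omit [CompleteSpace H] in
/-- `U ⊓ W` has an orthogonal projection when `U` and `W` are closed and `H` is complete (recorded for the consumers of `starProjection_inf_eq_mul_of_commute`). [cite: DeitmarEchterhoff2014, Lemma 7.3.1] -/
theorem hasOrthogonalProjection_inf [CompleteSpace H] (U W : Submodule ℂ H) (hUc : IsClosed (U : Set H)) (hWc : IsClosed (W : Set H)) : (U ⊓ W).HasOrthogonalProjection := by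
  have hc : IsClosed ((U ⊓ W : Submodule ℂ H) : Set H) := by
    rw [Submodule.coe_inf]
    exact hUc.inter hWc
  haveI : CompleteSpace (U ⊓ W : Submodule ℂ H) := hc.completeSpace_coe
  exact Submodule.HasOrthogonalProjection.ofCompleteSpace _

/-- **THE PEELING IDENTITY (F1)**: for elementwise-commuting families `S₁`, `S₂` with fixed vectors `U₁`, `U₂` and ANY family `S` between `S₁ ∪ S₂` and the subgroup it generates, with fixed
vectors `U`: **`P_U = P_{U₁} * P_{U₂}`** (`π` unitary). With `S₁ = φ_v(K_v)`, `S₂ = K^{T∪{v}}`, `S = K^T = S₁·S₂` this is `Pout T = Pl v * Pout (insert v T)` of ★ `K2E1HeckeCommuteGluingU`.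
[cite: Flath1979, §2 Example 2] [cite: Bump1997, §3.4 (pp. 314–315)] -/
theorem starProjection_fixed_eq_mul (hu : π.IsUnitary) (S₁ S₂ S : Set G) (U₁ U₂ U : Submodule ℂ H)
    (hU₁ : ∀ v : H, v ∈ U₁ ↔ ∀ s ∈ S₁, π s v = v) (hU₂ : ∀ v : H, v ∈ U₂ ↔ ∀ s ∈ S₂, π s v = v) (hU : ∀ v : H, v ∈ U ↔ ∀ s ∈ S, π s v = v)
    (h₁ : S₁ ⊆ S) (h₂ : S₂ ⊆ S) (hS : S ⊆ Subgroup.closure (S₁ ∪ S₂)) (hcomm : ∀ s ∈ S₁, ∀ t ∈ S₂, s * t = t * s)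
    [U₁.HasOrthogonalProjection] [U₂.HasOrthogonalProjection] [U.HasOrthogonalProjection] :
    U.starProjection = U₁.starProjection * U₂.starProjection := by
  have hUeq : U = U₁ ⊓ U₂ := fixed_eq_inf_of_subset_closure S₁ S₂ S U₁ U₂ U hU₁ hU₂ hU h₁ h₂ hS
  subst hUeq
  exact starProjection_inf_eq_mul_of_commute U₁ U₂ (commute_starProjection_of_commuting_families hu S₁ S₂ U₁ U₂ hU₁ hU₂ hcomm)

end Hilbert

end Summit.HodgeConjecture.HodgeConjecture.Cruxes.H413.K2E1FixedProjectionsCommuteU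

end
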